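import Summits.QuantumFields.BalabanUV.Beta.WilsonBackgroundWard22All

/-!
# The BACKGROUND-gauge Ward identity of the Wilson plaquette jets at order `(W², B¹)`; part 6: THE FLUCTUATION-COLOUR TRACE

Sixth file of (bgW₂) — READ THE HEADER of `Summits/QuantumFields/BalabanUV/Beta/WilsonBackgroundWard22.lean` (setting, provenance, honest
framing, what is NOT done).  THIS FILE is the LETTER-LEVEL kernel form of the observation (leaf-05-g3's toy, journal l.9794 (B)) that the
ROTATED-LETTER term of (bgW₂) dies under the trace over the fluctuation colour.  Everything is ring algebra for an arbitrary ring `𝔸`, an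
arbitrary `𝕜`-linear TRACIAL functional `τ` and an arbitrary finite letter family `t : C → 𝔸`; the only colour input is that the "Casimir"
`Σ_a t_a·t_a` commutes with the background and gauge letters (it is central for an orthonormal basis of a simple Lie algebra in an
irreducible representation — NOT proved or used here).

* §1 **ONE COLOUR DIRECTION IS ABELIAN AT ORDER `(2,1)`** (`two_smul_trace_P21_plaq_oneColour`): if the four fluctuation letters of the
  plaquette are scalar multiples `c₁•t, c₂•t, c₃•t, c₄•t` of ONE letter `t`, then for arbitrary background letters
  `2·τ(P21(plaq)) = (c₁ + c₂ − c₃ − c₄)² · τ(t·t·(B₁ + B₂ − B₃ − B₄))` — an3's graded closed form `WilsonVertex.two_smul_trace_P21`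
  (symmetric cubic + spin + transport) loses its spin term (`[t,t] = 0`) and its transport term (`τ(t·[β,t]) = 0` by traciality).
* §2 **THE COLOUR SUM AGAINST COMMUTATOR BACKGROUNDS VANISHES** (`sum_two_smul_trace_P21_plaq_oneColour`, `trace_casimir_comm`,
  `sum_trace_P21_plaq_comm_eq_zero`): summing §1 over `t = t_a` gives `(…)² · τ(C·Z_B)`, `C = Σ_a t_a·t_a`, and `τ(C·(P·Q − Q·P)) = 0`
  whenever `C` commutes with `P` (traciality) — so the sum vanishes when every background letter is a commutator `P_m·Q_m − Q_m·P_m` with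
  `[C, P_m] = 0`.
* §3 **THE TRACED (bgW₂) HAS NO ROTATED-LETTER TERM** (`bgWard22_trace`): for fluctuation letters `h_k = c_k • t_a` summed over `a`, gauge
  letters `l₁ … l₄` commuting with `C` and ARBITRARY background letters `B₁ … B₄`:
  `Σ_a ( 4·[F₂₂(h; B + W₀λ) − F₂₂(h; B) − F₂₂(h; W₀λ)] + 4·[F₂₁(h + ad_λ h; B) − F₂₁(h; B) − F₂₁(ad_λ h; B)] ) = 0`
  — part 4's `bgWard22'` summed over the colour, its third term killed by §2 (the rotated letters `[l₋ + l₊, B_m]` are commutators with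
  `P_m = l₋ + l₊`).

The stencil transcription (coordinates, colour stripping by completeness, `ℤ^{d+1}`) is NOT here; no statement about `SU(N)`, no Casimir
computed; the hypothesis `hC` is displayed, never discharged here.

NOT IN PRINT; OUR BOOKKEEPING (cell `pub-balaban`, β sub-cell, D1 formalisation swarm seat `b2b-balaban-beta-d1-formalise-leaf-09`, gen 3).
HONEST FRAMING (cell contract, verbatim): «discharging `BetaPertH` makes Bałaban's UV stability UNCONDITIONAL — a real constructive-QFT
result; it is NOT the continuum limit and NOT the Clay problem.»  HONEST DEPENDENCY (verbatim): «continuum YM on T⁴ ⇐ BetaPertH ∧ nine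
spine estimates (0/9 proved); BetaPertH ⇐ (D1) ∧ (D4) ∧ CAP+tail; G-an2-4 gates asym, D1 and NE2/3/4.»  THIS FILE DISCHARGES NOTHING of the
wall; [folklore] multilinear algebra; no binder of (D1) instantiated; not summit progress, not continuum, not Clay.  ABSOLUTE RULE (cell,
verbatim): «No internally-minted statement may enter as a cited fact. Every hypothesis is either kernel-proved in this package or a verbatim
quotation of a PUBLISHED theorem with page reference. The manuscript(s) under audit are NOT citable for their own disputed steps — they are
the thing under adjudication; programme-internal (2001/route/tribunal) claims are never citable.»  Nothing cited; no `def`; kernel-proved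
from part 4 and an3's closed form BY NAME.
-/

namespace Summit.QuantumFields.BalabanUV.Beta.WilsonBackgroundWard22Trace

open Literature.MathematicalPhysics.QuantumFieldTheory.Balaban1983to89.Beta.TransportVertices
open Literature.MathematicalPhysics.QuantumFieldTheory.Balaban1983to89.Beta.WilsonVertex
open Literature.MathematicalPhysics.QuantumFieldTheory.Balaban1983to89.Beta.WilsonVertex2
open Summit.QuantumFields.BalabanUV.Beta.WilsonBackgroundWard22All (bgWard22')
open scoped BigOperators

variable (𝕜 : Type*) [RCLike 𝕜] {𝔸 : Type*} [NormedRing 𝔸] [NormedAlgebra 𝕜 𝔸]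
variable {V : Type*} [AddCommGroup V] [Module 𝕜 V]

/-! ## §1 One colour direction: the `(2,1)`-jet is the symmetric cubic only -/

section OneColour

/-- [folklore] **ONE COLOUR DIRECTION IS ABELIAN AT ORDER `(2,1)`.**  For every ring `𝔸`, every `𝕜`-linear tracial `τ`, every letter `t`,
scalars `c₁ … c₄` and background letters `B₁ … B₄`:
`2·τ(P21(plaq (c₁•t) (c₂•t) (c₃•t) (c₄•t) B₁ B₂ B₃ B₄)) = (c₁ + c₂ − c₃ − c₄)² · τ(t·(t·(B₁ + B₂ − B₃ − B₄)))`. -/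
theorem two_smul_trace_P21_plaq_oneColour (τ : 𝔸 →ₗ[𝕜] V) (hτ : ∀ a b : 𝔸, τ (a * b) = τ (b * a)) (t : 𝔸) (c₁ c₂ c₃ c₄ : 𝕜)
    (B₁ B₂ B₃ B₄ : 𝔸) :
    (2 : 𝕜) • τ (P21 𝕜 (plaq (c₁ • t) (c₂ • t) (c₃ • t) (c₄ • t) B₁ B₂ B₃ B₄)) =
      ((c₁ + c₂ - c₃ - c₄) * (c₁ + c₂ - c₃ - c₄)) • τ (t * (t * (B₁ + B₂ - B₃ - B₄))) := by
  rw [two_smul_trace_P21 𝕜 τ hτ, wpart_plaq, bpart_plaq, twist_plaq, sum_four_signed, sum_four_signed, commSum_four]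
  have r1 : ∀ Z : 𝔸, τ (t * (Z * t)) = τ (t * (t * Z)) := fun Z => by rw [← mul_assoc, hτ]
  have r2 : ∀ Z : 𝔸, τ (Z * (t * t)) = τ (t * (t * Z)) := fun Z => by rw [hτ, mul_assoc]
  simp only [smul_mul_assoc, mul_smul_comm, mul_add, add_mul, mul_sub, sub_mul, neg_mul, mul_neg, smul_add, smul_sub, smul_neg,
    map_add, map_sub, map_neg, map_smul, r1, r2, sub_self, smul_zero, add_zero]
  module

/-- [folklore] In particular the `(2,1)`-jet of one colour direction sees the background only through the boundary sum `B₁ + B₂ − B₃ − B₄`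
(the lattice curl of the background around the plaquette): it VANISHES on curl-free background letters. -/
theorem trace_P21_plaq_oneColour_eq_zero_of_curlFree (τ : 𝔸 →ₗ[𝕜] V) (hτ : ∀ a b : 𝔸, τ (a * b) = τ (b * a)) (t : 𝔸)
    (c₁ c₂ c₃ c₄ : 𝕜) {B₁ B₂ B₃ B₄ : 𝔸} (hB : B₁ + B₂ - B₃ - B₄ = 0) :
    (2 : 𝕜) • τ (P21 𝕜 (plaq (c₁ • t) (c₂ • t) (c₃ • t) (c₄ • t) B₁ B₂ B₃ B₄)) = 0 := by
  rw [two_smul_trace_P21_plaq_oneColour 𝕜 τ hτ, hB, mul_zero, mul_zero, map_zero, smul_zero]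

end OneColour

/-! ## §2 The colour sum against commutator backgrounds -/

section ColourSum

variable {C : Type*} [Fintype C]

/-- [folklore] **THE COLOUR SUM OF §1**: `Σ_a 2·τ(P21(plaq (c•t_a) …)) = (c₁ + c₂ − c₃ − c₄)² · τ((Σ_a t_a·t_a)·(B₁ + B₂ − B₃ − B₄))`. -/
theorem sum_two_smul_trace_P21_plaq_oneColour (τ : 𝔸 →ₗ[𝕜] V) (hτ : ∀ a b : 𝔸, τ (a * b) = τ (b * a)) (t : C → 𝔸)
    (c₁ c₂ c₃ c₄ : 𝕜) (B₁ B₂ B₃ B₄ : 𝔸) :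
    (∑ a, (2 : 𝕜) • τ (P21 𝕜 (plaq (c₁ • t a) (c₂ • t a) (c₃ • t a) (c₄ • t a) B₁ B₂ B₃ B₄))) =
      ((c₁ + c₂ - c₃ - c₄) * (c₁ + c₂ - c₃ - c₄)) • τ ((∑ a, t a * t a) * (B₁ + B₂ - B₃ - B₄)) := by
  simp only [two_smul_trace_P21_plaq_oneColour 𝕜 τ hτ, ← Finset.smul_sum, ← map_sum, ← mul_assoc, ← Finset.sum_mul]

/-- [folklore] **A LETTER COMMUTING WITH `P` PAIRS TO ZERO WITH EVERY COMMUTATOR `[P, Q]` UNDER A TRACIAL FUNCTIONAL**: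
`C·P = P·C ⇒ τ(C·(P·Q − Q·P)) = 0`. -/
theorem trace_casimir_comm (τ : 𝔸 →ₗ[𝕜] V) (hτ : ∀ a b : 𝔸, τ (a * b) = τ (b * a)) {Cas P : 𝔸} (hC : Cas * P = P * Cas) (Q : 𝔸) :
    τ (Cas * (P * Q - Q * P)) = 0 := by
  rw [mul_sub, map_sub, sub_eq_zero, ← mul_assoc, hC, mul_assoc, hτ, mul_assoc]

/-- [folklore] **THE COLOUR SUM AGAINST COMMUTATOR BACKGROUNDS VANISHES.**  If `C = Σ_a t_a·t_a` commutes with `P₁ … P₄` then for all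
`Q₁ … Q₄` and all scalars:  `Σ_a 2·τ(P21(plaq (c₁•t_a) (c₂•t_a) (c₃•t_a) (c₄•t_a) [P₁,Q₁] [P₂,Q₂] [P₃,Q₃] [P₄,Q₄])) = 0`. -/
theorem sum_trace_P21_plaq_comm_eq_zero (τ : 𝔸 →ₗ[𝕜] V) (hτ : ∀ a b : 𝔸, τ (a * b) = τ (b * a)) (t : C → 𝔸)
    {P₁ P₂ P₃ P₄ : 𝔸} (h₁ : (∑ a, t a * t a) * P₁ = P₁ * ∑ a, t a * t a) (h₂ : (∑ a, t a * t a) * P₂ = P₂ * ∑ a, t a * t a)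
    (h₃ : (∑ a, t a * t a) * P₃ = P₃ * ∑ a, t a * t a) (h₄ : (∑ a, t a * t a) * P₄ = P₄ * ∑ a, t a * t a)
    (c₁ c₂ c₃ c₄ : 𝕜) (Q₁ Q₂ Q₃ Q₄ : 𝔸) :
    (∑ a, (2 : 𝕜) • τ (P21 𝕜 (plaq (c₁ • t a) (c₂ • t a) (c₃ • t a) (c₄ • t a)
        (P₁ * Q₁ - Q₁ * P₁) (P₂ * Q₂ - Q₂ * P₂) (P₃ * Q₃ - Q₃ * P₃) (P₄ * Q₄ - Q₄ * P₄)))) = 0 := by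
  rw [sum_two_smul_trace_P21_plaq_oneColour 𝕜 τ hτ]
  simp only [mul_add (∑ a, t a * t a), mul_sub (∑ a, t a * t a) (P₁ * Q₁ - Q₁ * P₁ + (P₂ * Q₂ - Q₂ * P₂)),
    mul_sub (∑ a, t a * t a) (P₁ * Q₁ - Q₁ * P₁ + (P₂ * Q₂ - Q₂ * P₂) - (P₃ * Q₃ - Q₃ * P₃)), map_add, map_sub,
    trace_casimir_comm 𝕜 τ hτ h₁, trace_casimir_comm 𝕜 τ hτ h₂, trace_casimir_comm 𝕜 τ hτ h₃, trace_casimir_comm 𝕜 τ hτ h₄,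
    add_zero, sub_zero, smul_zero]

end ColourSum

/-! ## §3 The traced background Ward identity -/

section Trace

variable {C : Type*} [Fintype C]

/-- [folklore] **THE FLUCTUATION-COLOUR TRACE OF (bgW₂) HAS NO ROTATED-LETTER TERM.**  For every ring `𝔸`, `𝕜`-linear tracial `τ`, finite
letter family `t : C → 𝔸` whose `C = Σ_a t_a·t_a` commutes with the four gauge letters `l₁ … l₄` (at the corners `x₁ … x₄`), all scalars
`c₁ … c₄` (the bond pattern of the fluctuation) and ALL background letters `B₁ … B₄`:
`Σ_a ( 4·[F₂₂(h; B + W₀λ) − F₂₂(h; B) − F₂₂(h; W₀λ)] + 4·[F₂₁(h + ad_λ h; B) − F₂₁(h; B) − F₂₁(ad_λ h; B)] ) = 0`, `h = (c₁•t_a, …, c₄•t_a)`,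
`W₀λ = (l₁ − l₂, l₂ − l₃, l₄ − l₃, l₁ − l₄)`, `ad_λ h = ([l₁,h₁], [l₂,h₂], [l₄,h₃], [l₁,h₄])` — part 4's `bgWard22'` summed over the colour,
the rotated-letter term `2·F₂₁(h; [l₋ + l₊, B])` summing to zero by `sum_trace_P21_plaq_comm_eq_zero`. -/
theorem bgWard22_trace (τ : 𝔸 →ₗ[𝕜] V) (hτ : ∀ a b : 𝔸, τ (a * b) = τ (b * a)) (t : C → 𝔸) (l₁ l₂ l₃ l₄ : 𝔸)
    (hl₁ : (∑ a, t a * t a) * l₁ = l₁ * ∑ a, t a * t a) (hl₂ : (∑ a, t a * t a) * l₂ = l₂ * ∑ a, t a * t a)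
    (hl₃ : (∑ a, t a * t a) * l₃ = l₃ * ∑ a, t a * t a) (hl₄ : (∑ a, t a * t a) * l₄ = l₄ * ∑ a, t a * t a)
    (c₁ c₂ c₃ c₄ : 𝕜) (B₁ B₂ B₃ B₄ : 𝔸) :
    (∑ a,
      ((4 : 𝕜) • τ (P22 𝕜 (plaq (c₁ • t a) (c₂ • t a) (c₃ • t a) (c₄ • t a)
          (B₁ + (l₁ - l₂)) (B₂ + (l₂ - l₃)) (B₃ + (l₄ - l₃)) (B₄ + (l₁ - l₄))))
        - (4 : 𝕜) • τ (P22 𝕜 (plaq (c₁ • t a) (c₂ • t a) (c₃ • t a) (c₄ • t a) B₁ B₂ B₃ B₄))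
        - (4 : 𝕜) • τ (P22 𝕜 (plaq (c₁ • t a) (c₂ • t a) (c₃ • t a) (c₄ • t a) (l₁ - l₂) (l₂ - l₃) (l₄ - l₃) (l₁ - l₄)))
      + ((4 : 𝕜) • τ (P21 𝕜 (plaq (c₁ • t a + (l₁ * (c₁ • t a) - (c₁ • t a) * l₁)) (c₂ • t a + (l₂ * (c₂ • t a) - (c₂ • t a) * l₂))
            (c₃ • t a + (l₄ * (c₃ • t a) - (c₃ • t a) * l₄)) (c₄ • t a + (l₁ * (c₄ • t a) - (c₄ • t a) * l₁)) B₁ B₂ B₃ B₄))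
          - (4 : 𝕜) • τ (P21 𝕜 (plaq (c₁ • t a) (c₂ • t a) (c₃ • t a) (c₄ • t a) B₁ B₂ B₃ B₄))
          - (4 : 𝕜) • τ (P21 𝕜 (plaq (l₁ * (c₁ • t a) - (c₁ • t a) * l₁) (l₂ * (c₂ • t a) - (c₂ • t a) * l₂)
            (l₄ * (c₃ • t a) - (c₃ • t a) * l₄) (l₁ * (c₄ • t a) - (c₄ • t a) * l₁) B₁ B₂ B₃ B₄))))) = 0 := by
  -- the Casimir commutes with the endpoint sums of the gauge letters
  have hs : ∀ {P P' : 𝔸}, (∑ a, t a * t a) * P = P * ∑ a, t a * t a → (∑ a, t a * t a) * P' = P' * ∑ a, t a * t a →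
      (∑ a, t a * t a) * (P + P') = (P + P') * ∑ a, t a * t a := fun hP hP' => by rw [mul_add, add_mul, hP, hP']
  -- the rotated-letter term sums to zero over the colour
  have h3 := sum_trace_P21_plaq_comm_eq_zero 𝕜 τ hτ t (hs hl₁ hl₂) (hs hl₂ hl₃) (hs hl₄ hl₃) (hs hl₁ hl₄) c₁ c₂ c₃ c₄ B₁ B₂ B₃ B₄
  -- per colour, (bgW₂) says the first two groups equal minus the rotated-letter term
  have h := fun a => eq_neg_of_add_eq_zero_left
    (bgWard22' 𝕜 τ (c₁ • t a) (c₂ • t a) (c₃ • t a) (c₄ • t a) B₁ B₂ B₃ B₄ l₁ l₂ l₃ l₄ hτ)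
  rw [Finset.sum_congr rfl fun a _ => h a, Finset.sum_neg_distrib, h3, neg_zero]

end Trace

end Summit.QuantumFields.BalabanUV.Beta.WilsonBackgroundWard22Trace
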